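import Summits.HodgeConjecture.HodgeConjecture.Theorems.K2E3RegularAdjointConeEstimates   -- ★ p855727 (this seat): FILE 1 — `norm_conj_sub_le`, `isUltrametricDist_matrix`, `isCompl_range_ker_ad`; brings ★ L6, ★ (U) `norm_mul_le_of_isUltrametricDist`
import HarnessLib

/-!
# Crux `H413` — K2-LIT E3 «EllipticInputs», U12-h engine (L6-inst), FILE 2: THE REGULAR ADJOINT EXPANSION `(hT)` — on `𝔮 = range(ad γ)` the map `X ↦ gXg⁻¹ − X` EXPANDS:
# `c‖X‖ ≤ ‖γXγ⁻¹ − X‖` (`γ` invertible, `𝔤 = 𝔱 ⊕ 𝔮`), and UNIFORMLY `c‖X‖ ≤ ‖(γt)X(γt)⁻¹ − X‖` for every `t` with `‖t − 1‖ < δ`, `‖t⁻¹‖ ≤ 1` (ultrametric perturbation: the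
# torus piece `T₁` of HC1999 §19 (2) is any compact open subgroup inside this ball)

Cell `hodgecm-mathlib`, Track B «K2-LIT», crux item `stmt-HodgeConjecture-24833` (h413), line `K2_E3_EllipticInputs`, unit U12 «HC characters», socket U12-h
`sig_K2E3CharLocConstNearRegular` (‹#9L›), depth-halving road (memo v4 `K2/K2E3-p09/g2/MEMO-U12h-HF-bricks.v4.K2E3-p09-g2.md` §2 brick (L6-inst), seat K2E1b-p08 (g2) for the 9L line lead
K2E3-p09 (g2)); `--supports stmt-HodgeConjecture-24833 --as helper`.  THEOREMS ONLY — no `def`, no named fact, no instance (scoped elementwise matrix norm), no notation, no `sorry`.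
GENERIC: `K` a nontrivially normed field, `IsUltrametricDist K`, complete where the finite-dimensional lower bound is taken; `𝔤 := Matrix (Fin N) (Fin N) K`, `ad γ := L_γ − R_γ`.
HONEST LABEL: HC_CM is proved only modulo the 7 printed citations (2 remaining named inputs: hLiu418 = stmt-HodgeConjecture-24832, h413 = stmt-HodgeConjecture-24833) until rung 0
closes; count-neutral.

THE MATHEMATICS [HarishChandra1999, §19 p. 82 (2) «there exists `c > 0` such that `|(Ad(γm) − 1)Y| ≥ c|Y|` for `m ∈ M₀` and `Y ∈ 𝔮`» — obtained «by choosing `Λ` sufficiently small»;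
Borel1991, I.4].
* §1 **POINTWISE AT `γ`**: if `range(ad γ) ⊓ ker(ad γ) = ⊥` (e.g. `γ` with separable characteristic polynomial, ★ chart-A) and `γ` is invertible, the linear map
  `X ↦ γXγ⁻¹ − X = (ad γ X)·γ⁻¹` is INJECTIVE on `𝔮 = range(ad γ)`, hence (finite dimension over a complete field, Mathlib `LinearMap.exists_antilipschitzWith`) **`∃ c > 0, ∀ X ∈ 𝔮,
  c‖X‖ ≤ ‖γXγ⁻¹ − X‖`** (`exists_pos_forall_mul_norm_le_norm_conj_sub`).
* §2 **ULTRAMETRIC PERTURBATION**: `(γt)X(γt)⁻¹ − X = γ(tXt⁻¹ − X)γ⁻¹ + (γXγ⁻¹ − X)` and `‖γ(tXt⁻¹ − X)γ⁻¹‖ ≤ ‖γ‖‖γ⁻¹‖‖t − 1‖‖X‖` (★ FILE 1 `norm_conj_sub_le`, ★ (U)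
  submultiplicativity); if `‖γ‖‖γ⁻¹‖‖t − 1‖ < c` the perturbation is STRICTLY smaller than `‖γXγ⁻¹ − X‖`, so by the strong triangle inequality the norm is unchanged:
  **`c‖X‖ ≤ ‖(γt)X(γt)⁻¹ − X‖`** (`mul_norm_le_norm_conj_mul_sub`) — no commutation of `t` with `γ` is needed for the ESTIMATE (it is needed for `hcomm`, ★ FILE 1).
* §3 **UNIFORM PACKAGE** (`exists_pos_pos_forall_mul_norm_le`): `∃ c > 0, ∃ δ > 0, ∀ t ∈ GL_N(K), ‖t − 1‖ < δ → ‖t⁻¹‖ ≤ 1 → ∀ X ∈ 𝔮, c‖X‖ ≤ ‖(γt)X(γt)⁻¹ − X‖` — HC's hypothesis (2)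
  with `M₀ := {t ∈ Z(γ) : ‖t − 1‖ < δ} ∩ GL_N(𝒪)` (every congruence torus piece `T₁ ⊆ K_m ∩ Z(γ)`, `q^{−m} < δ`, qualifies); the `hT` of ★ L6 `mul_norm_proj_le_of_eq_add` at `pq X ∈ 𝔮`.

## References
* [HarishChandra1999] Harish-Chandra (DeBacker–Sally), *Admissible Invariant Distributions on Reductive p-adic Groups*, ULECT 16 (1999), §18 p. 79, §19 p. 82 (2).
* [Borel1991] A. Borel, *Linear Algebraic Groups*, 2nd ed. (1991), I.4 (4.2, 4.4).
* [BoschGuntzerRemmert1984] S. Bosch, U. Güntzer, R. Remmert, *Non-Archimedean Analysis* (1984), §1.2.1.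
-/

set_option autoImplicit false
-- the mandated namespace repeats `HodgeConjecture.HodgeConjecture`, as in every `Theorems/*.lean` of this sub-problem
set_option linter.dupNamespace false

noncomputable section

open scoped MatrixGroups Matrix.Norms.Elementwise NNReal

namespace Summit.HodgeConjecture.HodgeConjecture.Cruxes.H413.K2E3RegularAdjointExpansion

variable {K : Type*} [NontriviallyNormedField K] {N : ℕ}

/-! ## §1 Pointwise expansion at `γ`: `X ↦ γXγ⁻¹ − X` is injective on `𝔮`, hence bounded below -/

/-- `γXγ⁻¹ − X = (γX − Xγ)·γ⁻¹ = (ad γ X)·γ⁻¹` for invertible `γ`. [folklore] -/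
theorem conj_sub_eq_ad_mul_inv (γ : GL (Fin N) K) (X : Matrix (Fin N) (Fin N) K) :
    (γ : Matrix (Fin N) (Fin N) K) * X * ((γ⁻¹ : GL (Fin N) K) : Matrix (Fin N) (Fin N) K) - X =
      ((LinearMap.mulLeft K (γ : Matrix (Fin N) (Fin N) K) - LinearMap.mulRight K (γ : Matrix (Fin N) (Fin N) K)) X) * ((γ⁻¹ : GL (Fin N) K) : Matrix (Fin N) (Fin N) K) := by
  have hγ : (γ : Matrix (Fin N) (Fin N) K) * ((γ⁻¹ : GL (Fin N) K) : Matrix (Fin N) (Fin N) K) = 1 := by rw [← Units.val_mul, mul_inv_cancel, Units.val_one]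
  rw [LinearMap.sub_apply, LinearMap.mulLeft_apply, LinearMap.mulRight_apply, Matrix.sub_mul, Matrix.mul_assoc X, hγ, Matrix.mul_one]

/-- **Injectivity on `𝔮`**: if `range(ad γ)` and `ker(ad γ)` meet trivially and `X ∈ range(ad γ)` has `γXγ⁻¹ = X`, then `X = 0` (`X` would lie in `ker(ad γ) ∩ range(ad γ)`).
[cite: Borel1991, I.4 (4.4)] -/
theorem eq_zero_of_conj_sub_eq_zero (γ : GL (Fin N) K)
    (h : Disjoint (LinearMap.range (LinearMap.mulLeft K (γ : Matrix (Fin N) (Fin N) K) - LinearMap.mulRight K (γ : Matrix (Fin N) (Fin N) K)))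
      (LinearMap.ker (LinearMap.mulLeft K (γ : Matrix (Fin N) (Fin N) K) - LinearMap.mulRight K (γ : Matrix (Fin N) (Fin N) K))))
    {X : Matrix (Fin N) (Fin N) K} (hX : X ∈ LinearMap.range (LinearMap.mulLeft K (γ : Matrix (Fin N) (Fin N) K) - LinearMap.mulRight K (γ : Matrix (Fin N) (Fin N) K)))
    (h0 : (γ : Matrix (Fin N) (Fin N) K) * X * ((γ⁻¹ : GL (Fin N) K) : Matrix (Fin N) (Fin N) K) - X = 0) : X = 0 := by
  have hker : X ∈ LinearMap.ker (LinearMap.mulLeft K (γ : Matrix (Fin N) (Fin N) K) - LinearMap.mulRight K (γ : Matrix (Fin N) (Fin N) K)) := by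
    rw [LinearMap.mem_ker]
    rw [conj_sub_eq_ad_mul_inv] at h0
    have h1 := congrArg (fun Y => Y * (γ : Matrix (Fin N) (Fin N) K)) h0
    simp only [Matrix.zero_mul, Matrix.mul_assoc] at h1
    rwa [← Units.val_mul, inv_mul_cancel, Units.val_one, Matrix.mul_one] at h1
  exact (Submodule.disjoint_def.1 h) X hX hker

/-- **(hT) POINTWISE EXPANSION AT `γ`: `∃ c > 0, ∀ X ∈ 𝔮, c‖X‖ ≤ ‖γXγ⁻¹ − X‖`** (`K` complete; `𝔮 = range(ad γ)` disjoint from `ker(ad γ)`, e.g. `γ` regular semisimple by ★ chart-A): the map is an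
injective linear map on the finite-dimensional `𝔮` (Mathlib `LinearMap.exists_antilipschitzWith`). [cite: HarishChandra1999, §19 p. 82 (2)] [cite: Borel1991, I.4 (4.4)] -/
theorem exists_pos_forall_mul_norm_le_norm_conj_sub [CompleteSpace K] (γ : GL (Fin N) K)
    (h : Disjoint (LinearMap.range (LinearMap.mulLeft K (γ : Matrix (Fin N) (Fin N) K) - LinearMap.mulRight K (γ : Matrix (Fin N) (Fin N) K)))
      (LinearMap.ker (LinearMap.mulLeft K (γ : Matrix (Fin N) (Fin N) K) - LinearMap.mulRight K (γ : Matrix (Fin N) (Fin N) K)))) :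
    ∃ c : ℝ, 0 < c ∧ ∀ X ∈ LinearMap.range (LinearMap.mulLeft K (γ : Matrix (Fin N) (Fin N) K) - LinearMap.mulRight K (γ : Matrix (Fin N) (Fin N) K)),
      c * ‖X‖ ≤ ‖(γ : Matrix (Fin N) (Fin N) K) * X * ((γ⁻¹ : GL (Fin N) K) : Matrix (Fin N) (Fin N) K) - X‖ := by
  set q := LinearMap.range (LinearMap.mulLeft K (γ : Matrix (Fin N) (Fin N) K) - LinearMap.mulRight K (γ : Matrix (Fin N) (Fin N) K)) with hq
  -- the conjugation-minus-identity map, restricted to `𝔮`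
  let Φ : Matrix (Fin N) (Fin N) K →ₗ[K] Matrix (Fin N) (Fin N) K :=
    LinearMap.mulRight K ((γ⁻¹ : GL (Fin N) K) : Matrix (Fin N) (Fin N) K) ∘ₗ LinearMap.mulLeft K (γ : Matrix (Fin N) (Fin N) K) - LinearMap.id
  have hΦ : ∀ X, Φ X = (γ : Matrix (Fin N) (Fin N) K) * X * ((γ⁻¹ : GL (Fin N) K) : Matrix (Fin N) (Fin N) K) - X := fun X => by
    simp only [Φ, LinearMap.sub_apply, LinearMap.comp_apply, LinearMap.mulLeft_apply, LinearMap.mulRight_apply, LinearMap.id_apply]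
  let f : q →ₗ[K] Matrix (Fin N) (Fin N) K := Φ ∘ₗ q.subtype
  have hf : ∀ X : q, f X = (γ : Matrix (Fin N) (Fin N) K) * (X : Matrix (Fin N) (Fin N) K) * ((γ⁻¹ : GL (Fin N) K) : Matrix (Fin N) (Fin N) K) - X := fun X => hΦ X
  have hker : LinearMap.ker f = ⊥ := by
    rw [LinearMap.ker_eq_bot']
    intro X hX0
    rw [hf] at hX0
    exact Subtype.ext (eq_zero_of_conj_sub_eq_zero γ h X.2 hX0)
  obtain ⟨Kc, hKc, hanti⟩ := f.exists_antilipschitzWith hker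
  refine ⟨(Kc : ℝ)⁻¹, inv_pos.2 (by exact_mod_cast hKc), fun X hX => ?_⟩
  have h1 := hanti.le_mul_norm (map_zero f) ⟨X, hX⟩
  rw [hf] at h1
  change ‖X‖ ≤ Kc * ‖(γ : Matrix (Fin N) (Fin N) K) * X * ((γ⁻¹ : GL (Fin N) K) : Matrix (Fin N) (Fin N) K) - X‖ at h1
  rwa [inv_mul_le_iff₀ (by exact_mod_cast hKc : (0 : ℝ) < Kc)]

/-! ## §2 Ultrametric perturbation: the expansion constant survives `γ ↦ γt` for `t` close to `1` -/

section Perturbation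

variable [IsUltrametricDist K]

omit [IsUltrametricDist K] in
/-- `(γt)X(γt)⁻¹ − X = γ(tXt⁻¹ − X)γ⁻¹ + (γXγ⁻¹ − X)`. [folklore] -/
theorem conj_mul_sub_eq (γ t : GL (Fin N) K) (X : Matrix (Fin N) (Fin N) K) :
    ((γ * t : GL (Fin N) K) : Matrix (Fin N) (Fin N) K) * X * (((γ * t)⁻¹ : GL (Fin N) K) : Matrix (Fin N) (Fin N) K) - X =
      (γ : Matrix (Fin N) (Fin N) K) * ((t : Matrix (Fin N) (Fin N) K) * X * ((t⁻¹ : GL (Fin N) K) : Matrix (Fin N) (Fin N) K) - X) * ((γ⁻¹ : GL (Fin N) K) : Matrix (Fin N) (Fin N) K) +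
        ((γ : Matrix (Fin N) (Fin N) K) * X * ((γ⁻¹ : GL (Fin N) K) : Matrix (Fin N) (Fin N) K) - X) := by
  rw [_root_.mul_inv_rev, Units.val_mul, Units.val_mul]
  noncomm_ring

/-- `‖γ Z γ⁻¹‖ ≤ ‖γ‖‖γ⁻¹‖‖Z‖` (★ submultiplicativity of the elementwise norm over an ultrametric coefficient field). [cite: BoschGuntzerRemmert1984, §1.2.1] -/
theorem norm_conj_le (γ : GL (Fin N) K) (Z : Matrix (Fin N) (Fin N) K) :
    ‖(γ : Matrix (Fin N) (Fin N) K) * Z * ((γ⁻¹ : GL (Fin N) K) : Matrix (Fin N) (Fin N) K)‖ ≤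
      ‖(γ : Matrix (Fin N) (Fin N) K)‖ * ‖((γ⁻¹ : GL (Fin N) K) : Matrix (Fin N) (Fin N) K)‖ * ‖Z‖ :=
  calc _ ≤ ‖(γ : Matrix (Fin N) (Fin N) K) * Z‖ * ‖((γ⁻¹ : GL (Fin N) K) : Matrix (Fin N) (Fin N) K)‖ := Literature.Analysis.Matrix.norm_mul_le_of_isUltrametricDist _ _
    _ ≤ ‖(γ : Matrix (Fin N) (Fin N) K)‖ * ‖Z‖ * ‖((γ⁻¹ : GL (Fin N) K) : Matrix (Fin N) (Fin N) K)‖ :=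
        mul_le_mul_of_nonneg_right (Literature.Analysis.Matrix.norm_mul_le_of_isUltrametricDist _ _) (norm_nonneg _)
    _ = _ := by ring

/-- Ultrametric absorption: `‖A‖ < ‖B‖ ⇒ ‖B‖ ≤ ‖A + B‖` (indeed `=`). [cite: BoschGuntzerRemmert1984, §1.2.1] -/
theorem norm_le_norm_add_of_norm_lt (A B : Matrix (Fin N) (Fin N) K) (h : ‖A‖ < ‖B‖) : ‖B‖ ≤ ‖A + B‖ := by
  haveI : IsUltrametricDist (Matrix (Fin N) (Fin N) K) := K2E3RegularAdjointConeEstimates.isUltrametricDist_matrix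
  rw [IsUltrametricDist.norm_add_eq_max_of_norm_ne_norm h.ne]
  exact le_max_right _ _

/-- **(hT) UNDER PERTURBATION**: if `c‖X‖ ≤ ‖γXγ⁻¹ − X‖`, `‖t⁻¹‖ ≤ 1` and `‖γ‖‖γ⁻¹‖‖t − 1‖ < c`, then **`c‖X‖ ≤ ‖(γt)X(γt)⁻¹ − X‖`** — the perturbation `γ(tXt⁻¹ − X)γ⁻¹` has norm
`≤ ‖γ‖‖γ⁻¹‖‖t − 1‖‖X‖ < c‖X‖ ≤ ‖γXγ⁻¹ − X‖` (★ FILE 1 `norm_conj_sub_le`) and is absorbed ultrametrically.  No commutation of `t` with `γ` is used. [cite: HarishChandra1999, §19 p. 82 (2)] -/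
theorem mul_norm_le_norm_conj_mul_sub (γ t : GL (Fin N) K) {c : ℝ} {X : Matrix (Fin N) (Fin N) K}
    (hc : c * ‖X‖ ≤ ‖(γ : Matrix (Fin N) (Fin N) K) * X * ((γ⁻¹ : GL (Fin N) K) : Matrix (Fin N) (Fin N) K) - X‖)
    (ht : ‖((t⁻¹ : GL (Fin N) K) : Matrix (Fin N) (Fin N) K)‖ ≤ 1)
    (hsmall : ‖(γ : Matrix (Fin N) (Fin N) K)‖ * ‖((γ⁻¹ : GL (Fin N) K) : Matrix (Fin N) (Fin N) K)‖ * ‖(t : Matrix (Fin N) (Fin N) K) - 1‖ < c) :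
    c * ‖X‖ ≤ ‖((γ * t : GL (Fin N) K) : Matrix (Fin N) (Fin N) K) * X * (((γ * t)⁻¹ : GL (Fin N) K) : Matrix (Fin N) (Fin N) K) - X‖ := by
  rw [conj_mul_sub_eq]
  by_cases hX : X = 0
  · subst hX
    rw [norm_zero, mul_zero]
    exact norm_nonneg _
  have hXpos : 0 < ‖X‖ := norm_pos_iff.2 hX
  -- the perturbation is strictly smaller than the main term
  have hA : ‖(γ : Matrix (Fin N) (Fin N) K) * ((t : Matrix (Fin N) (Fin N) K) * X * ((t⁻¹ : GL (Fin N) K) : Matrix (Fin N) (Fin N) K) - X) *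
      ((γ⁻¹ : GL (Fin N) K) : Matrix (Fin N) (Fin N) K)‖ < ‖(γ : Matrix (Fin N) (Fin N) K) * X * ((γ⁻¹ : GL (Fin N) K) : Matrix (Fin N) (Fin N) K) - X‖ := by
    calc _ ≤ ‖(γ : Matrix (Fin N) (Fin N) K)‖ * ‖((γ⁻¹ : GL (Fin N) K) : Matrix (Fin N) (Fin N) K)‖ *
          ‖(t : Matrix (Fin N) (Fin N) K) * X * ((t⁻¹ : GL (Fin N) K) : Matrix (Fin N) (Fin N) K) - X‖ := norm_conj_le γ _
      _ ≤ ‖(γ : Matrix (Fin N) (Fin N) K)‖ * ‖((γ⁻¹ : GL (Fin N) K) : Matrix (Fin N) (Fin N) K)‖ * (‖(t : Matrix (Fin N) (Fin N) K) - 1‖ * ‖X‖) :=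
          mul_le_mul_of_nonneg_left (K2E3RegularAdjointConeEstimates.norm_conj_sub_le t ht X) (mul_nonneg (norm_nonneg _) (norm_nonneg _))
      _ = ‖(γ : Matrix (Fin N) (Fin N) K)‖ * ‖((γ⁻¹ : GL (Fin N) K) : Matrix (Fin N) (Fin N) K)‖ * ‖(t : Matrix (Fin N) (Fin N) K) - 1‖ * ‖X‖ := by ring
      _ < c * ‖X‖ := mul_lt_mul_of_pos_right hsmall hXpos
      _ ≤ _ := hc
  exact hc.trans (norm_le_norm_add_of_norm_lt _ _ hA)

end Perturbation

/-! ## §3 The uniform package: one constant `c` and one radius `δ` for all `t` near `1` -/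

/-- **(hT) UNIFORM EXPANSION ON `𝔮`** (`K` complete and ultrametric; `range(ad γ) ⊓ ker(ad γ) = ⊥`): **`∃ c > 0, ∃ δ > 0, ∀ t ∈ GL_N(K), ‖t − 1‖ < δ → ‖t⁻¹‖ ≤ 1 → ∀ X ∈ range(ad γ),
c‖X‖ ≤ ‖(γt)X(γt)⁻¹ − X‖`** — HC1999 §19 (2) with `M₀` any compact open piece of the centraliser torus inside the ball `‖t − 1‖ < δ` of `GL_N(𝒪)` (congruence pieces `Z(γ) ∩ K_m`,
`q^{−m} < δ`); the hypothesis `hT` of ★ L6 `mul_norm_proj_le_of_eq_add` at `pq X ∈ 𝔮` (with `hcomm` from ★ FILE 1 when `t` commutes with `γ`). [cite: HarishChandra1999, §19 p. 82 (2)] -/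
theorem exists_pos_pos_forall_mul_norm_le [CompleteSpace K] [IsUltrametricDist K] (γ : GL (Fin N) K)
    (h : Disjoint (LinearMap.range (LinearMap.mulLeft K (γ : Matrix (Fin N) (Fin N) K) - LinearMap.mulRight K (γ : Matrix (Fin N) (Fin N) K)))
      (LinearMap.ker (LinearMap.mulLeft K (γ : Matrix (Fin N) (Fin N) K) - LinearMap.mulRight K (γ : Matrix (Fin N) (Fin N) K)))) :
    ∃ c : ℝ, 0 < c ∧ ∃ δ : ℝ, 0 < δ ∧ ∀ t : GL (Fin N) K, ‖(t : Matrix (Fin N) (Fin N) K) - 1‖ < δ → ‖((t⁻¹ : GL (Fin N) K) : Matrix (Fin N) (Fin N) K)‖ ≤ 1 →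
      ∀ X ∈ LinearMap.range (LinearMap.mulLeft K (γ : Matrix (Fin N) (Fin N) K) - LinearMap.mulRight K (γ : Matrix (Fin N) (Fin N) K)),
        c * ‖X‖ ≤ ‖((γ * t : GL (Fin N) K) : Matrix (Fin N) (Fin N) K) * X * (((γ * t)⁻¹ : GL (Fin N) K) : Matrix (Fin N) (Fin N) K) - X‖ := by
  obtain ⟨c, hc, hcX⟩ := exists_pos_forall_mul_norm_le_norm_conj_sub γ h
  set M : ℝ := ‖(γ : Matrix (Fin N) (Fin N) K)‖ * ‖((γ⁻¹ : GL (Fin N) K) : Matrix (Fin N) (Fin N) K)‖ with hM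
  have hM0 : 0 ≤ M := mul_nonneg (norm_nonneg _) (norm_nonneg _)
  refine ⟨c, hc, c / (M + 1), div_pos hc (by linarith), fun t htδ ht X hX => mul_norm_le_norm_conj_mul_sub γ t (hcX X hX) ht ?_⟩
  calc M * ‖(t : Matrix (Fin N) (Fin N) K) - 1‖ ≤ M * (c / (M + 1)) := mul_le_mul_of_nonneg_left htδ.le hM0
    _ < c := by
        rw [mul_div_assoc']
        rw [div_lt_iff₀ (by linarith)]
        nlinarith

/-- The regular semisimple case packaged: for `γ ∈ GL_N(K)` with separable characteristic polynomial (`K` perfect, e.g. characteristic `0`), the disjointness holds by ★ chart-A, so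
`∃ c > 0, ∃ δ > 0, …` as above. [cite: HarishChandra1999, §19 p. 82 (2)] [cite: Borel1991, I.4 (4.2, 4.4)] -/
theorem exists_pos_pos_forall_mul_norm_le_of_separable [CompleteSpace K] [IsUltrametricDist K] [PerfectField K] (γ : GL (Fin N) K)
    (hγ : (γ : Matrix (Fin N) (Fin N) K).charpoly.Separable) :
    ∃ c : ℝ, 0 < c ∧ ∃ δ : ℝ, 0 < δ ∧ ∀ t : GL (Fin N) K, ‖(t : Matrix (Fin N) (Fin N) K) - 1‖ < δ → ‖((t⁻¹ : GL (Fin N) K) : Matrix (Fin N) (Fin N) K)‖ ≤ 1 →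
      ∀ X ∈ LinearMap.range (LinearMap.mulLeft K (γ : Matrix (Fin N) (Fin N) K) - LinearMap.mulRight K (γ : Matrix (Fin N) (Fin N) K)),
        c * ‖X‖ ≤ ‖((γ * t : GL (Fin N) K) : Matrix (Fin N) (Fin N) K) * X * (((γ * t)⁻¹ : GL (Fin N) K) : Matrix (Fin N) (Fin N) K) - X‖ :=
  exists_pos_pos_forall_mul_norm_le γ (K2E3RegularAdjointConeEstimates.isCompl_range_ker_ad (γ : Matrix (Fin N) (Fin N) K) hγ).disjoint

end Summit.HodgeConjecture.HodgeConjecture.Cruxes.H413.K2E3RegularAdjointExpansion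

end
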